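import Summits.RiemannHypothesis.RiemannHypothesis.Theorems.GroundBartaEvenWinsBeyondArchDeflationM80PFinal
import HarnessLib

/-!
# RiemannHypothesis / GroundBarta — CALIBRATION twin (format A′, rh-explicit STEP-0 row B-W-format-A′) of the even positivity block at
# `c = 4023/5000`: the final inequality modulo R-layer data, from ANY even-sector β-certificate bound of length `178`

Helper file (`--supports stmt-RiemannHypothesis-0098 --as helper`), RH-free; seat rh-explicit-weil-6 (memo `run/shared/lean/pub/rh-explicit/WEIL6-APRIME.md`
§1.2).  Verbatim twin of prover A g9's `dt_m80P_evenLower_of_gramW` (`…DeflationM80PFinal.lean`) in which the certificate input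
`deflBound_weilCertDeflM80P` (format A = `WeilCert23`, `N + 1 = 272`) is replaced by a HYPOTHESIS `hcert178`: the same complement bound
`17/25 · ‖g‖² ≤ E₂₃(g) + Σ_i μ_i |Σ_{k<178} ĉ_{ik} M_k(g)|²` with the SAME penalties `weilCertDeflM80PR` but moment cut-off `178` — the shape delivered
by the format-A′ calibration certificate `weilCertDeflM80X` (`WeilCert23X` on the T80 chain, `N = 177`; `…WeilTwoPrimeDeflM80XCert.lean`).  Since the
penalty lists vanish beyond index `54`, the bridge `dt_weilEvenGroundEnergy_ge_of_deflCert_w` (prover B) runs at length `178` with the same trial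
vectors `m80Pv` (`m80X_trim`, `m80X_mask`); A-layer, Markov bound, cross-Gram step and prover B's weighted R-layer interface are reused BY NAME
(`m80PF`, `m80PMhi`, `m80PTAlo/hi`, …).  Instantiated in `…DeflationM80XEvenLowerGW.lean` with prover B's data exactly as `m80P_evenLower_litW`.
-/

set_option linter.dupNamespace false

noncomputable section

open MeasureTheory Set
open scoped BigOperators ComplexConjugate

namespace Summit.RiemannHypothesis.RiemannHypothesis.Theorems.EvenWinsBeyondArch


open Literature.NumberTheory.LFunctions Literature.Analysis.ValidatedNumerics.ExpPoly
open Literature.Analysis.ValidatedNumerics.PolyMP Summit.RiemannHypothesis.RiemannHypothesis.Theorems.EvenWinsBeyondArch.ArchM80P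
open Summit.RiemannHypothesis.RiemannHypothesis.Theorems.OddSector (weilDirichletEnergy₂ weilPoleForm₂)
open Summit.RiemannHypothesis.RiemannHypothesis.Theorems.GroundStateSimpleEven (tuf_log_two_bounds)

open Literature.Analysis.ValidatedNumerics.PolyMP

set_option maxHeartbeats 0 in
/-- The certificate's masked coefficient vectors CUT AT `178` are the trimmed data polynomials `P_i` padded with zeros. [folklore] -/
theorem m80X_trim : ∀ i : Fin 6, (List.range 178).map (maskV (weilCertDeflM80PR.get (Fin.cast m80P_Rlen.symm i))) =
    m80PP i ++ List.replicate (178 - (m80PP i).length) 0 := by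
  decide +kernel

/-- **The bridge's trial vectors at length `178` are the A-layer vectors**: `𝟙_{[-c,c]}·maskPoly(r_i, 178, c) = m80Pv i`. [folklore] -/
theorem m80X_mask (i : Fin 6) (x : ℝ) :
    (((Icc (-(4023 / 5000 : ℝ)) (4023 / 5000)).indicator (fun x ↦ maskPoly (weilCertDeflM80PR.get (Fin.cast m80P_Rlen.symm i)) 178 (4023 / 5000) x) x
        : ℝ) : ℂ) = m80Pv i x := by
  unfold m80Pv
  rw [dt_wY_apply]
  push_cast
  congr 1
  by_cases hx : x ∈ Icc (-(4023 / 5000 : ℝ)) (4023 / 5000)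
  · rw [indicator_of_mem hx, indicator_of_mem (by simpa using hx), maskPoly_eq_poly_eval_of_trim _ _ (m80X_trim i)]
  · rw [indicator_of_notMem hx, indicator_of_notMem (by simpa using hx)]

/-- **`λ ≤ ε_ev(4023/5000)` modulo WEIGHTED R-layer data, from any length-178 even complement bound with the M80P penalties** (format-A′
calibration twin of `dt_m80P_evenLower_of_gramW`; statement otherwise identical — see that theorem's docstring for the data). [folklore] -/
theorem dt_m80X_evenLower_of_gramW_of_bound
    (hcert178 : ∀ g : ℝ → ℂ, IsWeilTest g → tsupport g ⊆ Icc (-(4023 / 5000 : ℝ)) (4023 / 5000) → (∀ x, g (-x) = g x) →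
      (17 / 25 : ℝ) * weilNorm2Sq g ≤ weilTwoPrimeQuadratic g +
        (weilCertDeflM80PR.map fun r ↦ (r.1 : ℝ) * ‖∑ k ∈ Finset.range 178, ((maskV r k : ℚ) : ℂ) * weilMoment (4023 / 5000 : ℝ) g k‖ ^ 2).sum)
    (W : Fin 6 → Fin 6 → ℝ) (lam κ₂ wI wE y₁ : ℚ) (hκ : Real.log 2 / 2 ≤ (κ₂ : ℝ))
    (hlam : lam + κ₂ < 17 / 25) (hwI : wI = 1 / (17 / 25 - lam)) (hwE : wE = 1 / (17 / 25 - κ₂ - lam))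
    (hy : (y₁ : ℝ) ≤ Real.log 4 - 4023 / 5000) (sW : Fin 6 → ℚ)
    (hsW : ∀ i, ∫ y, {u : ℝ | (y₁ : ℝ) ≤ |u|}.piecewise (fun _ ↦ (wE : ℝ)) (fun _ ↦ (wI : ℝ)) y *
      ‖(m80PF i - ∑ l, W i l • m80Pv l) y‖ ^ 2 ≤ (sW i : ℝ))
    (Rlo Rhi : Fin 6 → Fin 6 → ℚ) (hRdiag : ∀ i, Rlo i i = sW i ∧ Rhi i i = sW i)
    (hR : ∀ i j, i ≠ j →
      (Rlo i j : ℝ) ≤ ∫ y, {u : ℝ | (y₁ : ℝ) ≤ |u|}.piecewise (fun _ ↦ (wE : ℝ)) (fun _ ↦ (wI : ℝ)) y *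
          ((m80PF i - ∑ l, W i l • m80Pv l) y * conj ((m80PF j - ∑ l, W j l • m80Pv l) y)).re ∧
        ∫ y, {u : ℝ | (y₁ : ℝ) ≤ |u|}.piecewise (fun _ ↦ (wE : ℝ)) (fun _ ↦ (wI : ℝ)) y *
          ((m80PF i - ∑ l, W i l • m80Pv l) y * conj ((m80PF j - ∑ l, W j l • m80Pv l) y)).re ≤ (Rhi i j : ℝ))
    {m : ℕ} (sc : Fin 6 → ℚ) (hsc : ∀ i, 0 < sc i) (P E : Fin 6 → Fin 6 → ℚ)
    (D : Fin m → ℚ) (L : Fin m → Fin 6 → ℚ) (δ : ℚ)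
    (hPE : ∀ i j, ∀ a ∈ [m80PTAlo i j - m80PMhi * m80PG i j, m80PTAhi i j - m80PMhi * m80PG i j],
      P i j - E i j ≤ sc i * sc j * nEntry (lam + 1) lam (m80PG i j) (Rhi i j) a ∧
        sc i * sc j * nEntry (lam + 1) lam (m80PG i j) (Rlo i j) a ≤ P i j + E i j)
    (hrow : ∀ i, ∑ j, E i j ≤ δ) (hcol : ∀ j, ∑ i, E i j ≤ δ) (hD : ∀ r, 0 ≤ D r)
    (hP : ∀ i j, P i j = δ * (if i = j then 1 else 0) + ∑ r, D r * L r i * L r j) :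
    (lam : ℝ) ≤ weilEvenGroundEnergy (4023 / 5000 : ℝ) := by
  classical
  have hc : (0 : ℝ) < 4023 / 5000 := by norm_num
  have hc5 : (4023 / 5000 : ℝ) ≤ Real.log 5 / 2 := by have := m80_le_log5; push_cast at this; linarith
  have hlamQ : ((lam : ℚ) : ℝ) + (κ₂ : ℝ) < 17 / 25 := by
    have h := (Rat.cast_lt (K := ℝ)).2 hlam; push_cast at h; exact h
  have hlamR : (lam : ℝ) < 17 / 25 - (κ₂ : ℝ) := by linarith
  have hlog0 : 0 < Real.log 2 / 2 := by positivity
  have hnI : (0 : ℝ) < 17 / 25 - lam := by linarith [hlog0.le.trans hκ]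
  have hnE : (0 : ℝ) < 17 / 25 - κ₂ - lam := by linarith
  have hwIR : (wI : ℝ) = 1 / (17 / 25 - (lam : ℝ)) := by rw [hwI]; push_cast; ring
  have hwER : (wE : ℝ) = 1 / (17 / 25 - (κ₂ : ℝ) - (lam : ℝ)) := by rw [hwE]; push_cast; ring
  have hcert := hcert178
  have hM : weilMarkovConstant (4023 / 5000 : ℝ) ≤ ((m80PMhi : ℚ) : ℝ) := by
    have h2 := m80_log2_lt; have h5 := m80_le_log5; push_cast at h2 h5
    have := (dt_weilMarkovConstant_sharp3 h2 h5).2; unfold m80PMhi; push_cast at this ⊢; exact this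
  have hA := m80P_TA_mem
  have hG := m80P_inner
  -- the weight, the residuals and their weighted copies `r̃_i = √w · r_i`
  set Ew : Set ℝ := {u : ℝ | (y₁ : ℝ) ≤ |u|} with hEw
  set w : ℝ → ℝ := Ew.piecewise (fun _ ↦ (wE : ℝ)) (fun _ ↦ (wI : ℝ)) with hwdef
  have hw0 : ∀ y, 0 ≤ w y := by
    intro y
    by_cases hy' : y ∈ Ew
    · rw [hwdef, Set.piecewise_eq_of_mem _ _ _ hy', hwER]; positivity
    · rw [hwdef, Set.piecewise_eq_of_notMem _ _ _ hy', hwIR]; positivity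
  set r : Fin 6 → ℝ → ℂ := fun i ↦ m80PF i - ∑ l, W i l • m80Pv l with hr
  set rt : Fin 6 → ℝ → ℂ := fun i y ↦ ((Real.sqrt (w y) : ℝ) : ℂ) * r i y with hrt
  have hrt_sq : ∀ i, ∫ y, ‖rt i y‖ ^ 2 = ∫ y, w y * ‖r i y‖ ^ 2 := fun i ↦
    integral_congr_ae (Filter.Eventually.of_forall fun y ↦ dt_norm_sq_sqrt_mul (hw0 y) _)
  have hrt_cross : ∀ i j, ∫ y, (rt i y * conj (rt j y)).re = ∫ y, w y * (r i y * conj (r j y)).re := fun i j ↦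
    integral_congr_ae (Filter.Eventually.of_forall fun y ↦ dt_sqrt_mul_pairing_pt hw0 (r i) (r j) y)
  -- the matrix `R'_w` (certified diagonal bounds, true weighted cross terms) and its boxes
  set Rm : Fin 6 → Fin 6 → ℝ := fun i j ↦ if i = j then ((sW i : ℚ) : ℝ) else ∫ y, (rt i y * conj (rt j y)).re with hRm
  have hRbox : ∀ i j, (Rlo i j : ℝ) ≤ Rm i j ∧ Rm i j ≤ (Rhi i j : ℝ) := by
    intro i j
    by_cases hij : i = j
    · subst hij
      obtain ⟨h1, h2⟩ := hRdiag i
      simp only [hRm, if_true, h1, h2]; exact ⟨le_rfl, le_rfl⟩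
    · simp only [hRm, if_neg hij, hrt_cross, hr, hwdef, hEw]
      exact hR i j hij
  -- kernel certificate ⇒ `(A − λG) − R'_w ⪰ 0` (β' = λ + 1)
  have hPE' : ∀ i j, ∀ β' ∈ [lam + 1, lam + 1], ∀ a ∈ [m80PTAlo i j - m80PMhi * m80PG i j, m80PTAhi i j - m80PMhi * m80PG i j],
      P i j - E i j ≤ sc i * sc j * nEntry β' lam (m80PG i j) (Rhi i j) a ∧
        sc i * sc j * nEntry β' lam (m80PG i j) (Rlo i j) a ≤ P i j + E i j := by
    intro i j β' hβ' a ha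
    have : β' = lam + 1 := by simpa using hβ'
    subst this
    exact hPE i j a ha
  have hN := dt_hN_of_boundsT₃
    (fun i j ↦ weilPoleForm₂ (m80Pv i) (m80Pv j) + weilDirichletEnergy₂ (((4023 / 5000 : ℚ)) : ℝ) (m80Pv i) (m80Pv j))
    m80PTAlo m80PTAhi m80PG hA (fun i j ↦ ∫ x, (m80Pv i x * conj (m80Pv j x)).re) hG
    (M := weilMarkovConstant (4023 / 5000 : ℝ)) m80PMhi hM m80PGD m80PGL m80P_G_ldl.1 m80P_G_ldl.2
    (β := (lam : ℝ) + 1) (lam + 1) (lam + 1) (by push_cast; exact ⟨le_rfl, le_rfl⟩) Rm Rlo Rhi hRbox lam (by linarith)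
    sc hsc P E D L δ hPE' hrow hcol hD hP
  have h1825 : (((4023 / 5000 : ℚ)) : ℝ) = (4023 / 5000 : ℝ) := by norm_num
  simp only [h1825, add_sub_cancel_left, one_mul] at hN
  -- cross-Gram criterion on the weighted residuals ⇒ the bridge's weighted `hPSD`
  have hsR : ∀ i, ∫ y, ‖rt i y‖ ^ 2 ≤ ((sW i : ℚ) : ℝ) := fun i ↦ by
    rw [hrt_sq]; simpa only [hr, hwdef, hEw] using hsW i
  have hPSD := dt_psd_of_crossGram
    (fun i j ↦ (weilPoleForm₂ (m80Pv i) (m80Pv j) + weilDirichletEnergy₂ (4023 / 5000 : ℝ) (m80Pv i) (m80Pv j) -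
          weilMarkovConstant (4023 / 5000 : ℝ) * ∫ x, (m80Pv i x * conj (m80Pv j x)).re) -
        (lam : ℝ) * ∫ x, (m80Pv i x * conj (m80Pv j x)).re)
    rt (fun i ↦ ((sW i : ℚ) : ℝ)) hsR (fun α ↦ by simpa only [hRm] using hN α)
  -- the weight in the bridge's form
  have hwform : ∀ y, w y = Ew.piecewise (fun _ ↦ 1 / (17 / 25 - (κ₂ : ℝ) - (lam : ℝ))) (fun _ ↦ 1 / (17 / 25 - (lam : ℝ))) y := by
    intro y
    by_cases hy' : y ∈ Ew
    · rw [hwdef, Set.piecewise_eq_of_mem _ _ _ hy', Set.piecewise_eq_of_mem _ _ _ hy', hwER]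
    · rw [hwdef, Set.piecewise_eq_of_notMem _ _ _ hy', Set.piecewise_eq_of_notMem _ _ _ hy', hwIR]
  have hPSD' : ∀ α : Fin 6 → ℝ, 0 ≤ ∑ i, ∑ j, α i * α j *
      ((weilPoleForm₂ (m80Pv i) (m80Pv j) + weilDirichletEnergy₂ (4023 / 5000 : ℝ) (m80Pv i) (m80Pv j) -
          weilMarkovConstant (4023 / 5000 : ℝ) * ∫ x, (m80Pv i x * conj (m80Pv j x)).re) -
        (lam : ℝ) * (∫ x, (m80Pv i x * conj (m80Pv j x)).re) -
        ∫ y, Ew.piecewise (fun _ ↦ 1 / (17 / 25 - (κ₂ : ℝ) - (lam : ℝ))) (fun _ ↦ 1 / (17 / 25 - (lam : ℝ))) y *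
          ((m80PF i - ∑ l, W i l • m80Pv l) y * conj ((m80PF j - ∑ l, W j l • m80Pv l) y)).re) := by
    intro α
    have h := hPSD α
    have e : ∀ i j, ∫ y, (rt i y * conj (rt j y)).re =
        ∫ y, Ew.piecewise (fun _ ↦ 1 / (17 / 25 - (κ₂ : ℝ) - (lam : ℝ))) (fun _ ↦ 1 / (17 / 25 - (lam : ℝ))) y *
          ((m80PF i - ∑ l, W i l • m80Pv l) y * conj ((m80PF j - ∑ l, W j l • m80Pv l) y)).re := by
      intro i j
      rw [hrt_cross]
      exact integral_congr_ae (Filter.Eventually.of_forall fun y ↦ by simp only [hr, hwform y])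
    simpa only [e] using h
  exact dt_weilEvenGroundEnergy_ge_of_deflCert_w hc hc5 le_rfl weilCertDeflM80PR 178 m80P_Reven.1 m80P_Reven.2 hcert
    m80Pv m80PF (fun i x ↦ (m80X_mask i x).symm) (fun i y ↦ rfl) W hκ hlamR hy hPSD'

end Summit.RiemannHypothesis.RiemannHypothesis.Theorems.EvenWinsBeyondArch

end
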